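import Literature.AlgebraicGeometry.Frobenioids.Prop25SubProofs
import Literature.AlgebraicGeometry.Frobenioids.Prop25SubPsiProofs
import Literature.AlgebraicGeometry.Frobenioids.Cor26SubProofs
import Literature.AlgebraicGeometry.Frobenioids.PadicFrobenioidQpFrobeniusFunctors
import HarnessLib

/-!
# [FrdI] Prop. 2.5 (iii) / Cor. 2.6 (W7): the setting `FrdI.P25.Setting` and the data `FrdI.P25.Cor26Data`
# at the `p`-ADIC Frobenioid — genuine witnesses ([FrdII] Rmk. 1.2.1), premise-free at `C^⊢(ℚ_p)`

Mochizuki, *The geometry of Frobenioids I: the general theory*, Kyushu J. Math. **62** (2008) 293–400,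
Prop. 2.5 p. 48 (standing hypotheses: "`C` a Frobenioid of Frobenius-normalized, metrically trivial and
`Aut`-ample type"), Cor. 2.6 pp. 50–51 (the unit-wise Frobenius functor `Ψ := Ψ₂ ∘ Ψ₁`)
[cite: MochizukiFrdI2008, Prop. 2.5 p.48] [cite: MochizukiFrdI2008, Cor. 2.6 p.50]; Mochizuki, *The geometry
of Frobenioids II: poly-Frobenioids*, Kyushu J. Math. **62** (2008) 401–460, Rmk. 1.2.1 (kurims p. 10): "if `Φ`
is absolutely primitive, then by Theorem 1.2(i) and (v), it follows that `C` admits unit-linear Frobenius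
functors as in [Mzk5, Proposition 2.5(iii)] …, and unit-wise Frobenius functors as in [Mzk5, Corollary 2.6]"
[cite: MochizukiFrdII2008, Rmk 1.2.1 p.10].

PROOF-ONLY companion (seat abc-iut-L1-d4 gen 5; no definitions, no named facts), row «NV-L1/P25-padic» of
the L1 non-vacuity register (L1-lead R113 (2); the generic producer of record `FrdI.P25.Cor26Data.nonempty`
and the ARCHIMEDEAN witnesses are abc-iut-L6-t9's `Cor26DataNonVacuity.lean` p423713 — not imported here only
because its olean was not yet on the farm at filing time; `Cor26Data.nonempty_at` below is the `hF`-explicit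
form of the same three-row assembly, kept self-contained). This file adds the NONARCHIMEDEAN witnesses — the context in which [FrdII] Rmk. 1.2.1 applies Prop. 2.5 (iii) / Cor. 2.6, and the
one [IUTchI] Ex. 3.2/3.3 use at `v ∈ V^non`:

* `PadicFrd.Datum.p25Setting_of_isAbsolutelyPrimitive` — GENUINE (`nonempty_genuine`): the `p`-adic Frobenioid
  of a datum with `Φ`, `B` monoids on `D` and `Φ` absolutely primitive satisfies `FrdI.P25.Setting`, by exactly
  the inputs Rmk. 1.2.1 names: a Frobenioid (`isFrobenioid_of_isMonoidData`, abc-iut-L1-d8), Frobenius-normalized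
  (every model Frobenioid, `ModelFrobenioid.isOfType_isFrobeniusNormalized`), metrically trivial (base-trivial,
  Thm. 1.2 (v), `isOfType_isMetricallyTrivial_of_isAbsolutelyPrimitive`), `Aut`-ample (Thm. 1.2 (i),
  `thm12_isAutAmple`); hence `nonempty_cor26Data_pSplitting` at the characteristic splitting `τ_p` (and at any `τ`).
* `PadicFrd.p25Setting_primQp`, `PadicFrd.nonempty_cor26Data_primQp` — PREMISE-FREE at `C^⊢(ℚ_p)`
  (`Datum.primQp`, `τQp`; abc-iut-L1-t4 / abc-iut-w5-d214 lineages), every `d ∈ ℕ_{≥1}`.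
* `FrdI.P25.exists_cor26Data_unitWise` / `PadicFrd.unitWise_abcd_primQp` — consequently the W7 rows (a)–(d) of
  Cor. 2.6 (abc-iut-L6-t9's `unitWise_a/b/c/d_holds`, typed "`Setting F → ∀ Δ : Cor26Data τ d hF, …`") FIRE at a
  genuine nonarchimedean instance.

A zero row of the census is "not yet witnessed", never "vacuous"; nothing here bears on, or takes a side on,
[IUTchIII] Cor. 3.12; no statement of either paper is strengthened.
-/

noncomputable section

namespace Literature.AlgebraicGeometry.Frobenioids

open CategoryTheory Opposite

/-! ### 1. Generic consequence: the Cor. 2.6 rows fire under `Setting F` -/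

namespace FrdI.P25

open PreFrobenioid

universe w v v' u u'

variable {D : Type u} [Category.{v} D] {Φ : Dᵒᵖ ⥤ CommMonCat.{w}}
  {C : Type u'} [Category.{v'} C] (F : C ⥤ ElemFrobenioid Φ)

/-- The data of Cor. 2.6 at an ARBITRARY Frobenioid witness `hF` (the `hF`-explicit form of abc-iut-L6-t9's
`Cor26Data.nonempty`; same assembly of the landed rows C26-L01 `naiveFactorsThroughCd_holds`, P25-L07
`psiUnitLinearData_holds`, P25-L08 `psiEquivalence_holds`). [cite: MochizukiFrdI2008, Cor. 2.6 p.51] -/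
theorem Cor26Data.nonempty_at (hS : Setting F) (τ : CharacteristicSplitting F) (d : ℕ+)
    (hF : IsFrobenioid F) : Nonempty (Cor26Data τ d hF) := by
  obtain ⟨Ψ₁, hΨ₁⟩ := naiveFactorsThroughCd_holds F d hF
  obtain ⟨U, hU, -⟩ := psiUnitLinearData_holds (F := F) τ d hS
  exact ⟨⟨Ψ₁, hΨ₁, U, hU, psiEquivalence_holds (F := F) τ d hS U hU⟩⟩

/-- Under `Setting F`, for every `τ`, `d` and every Frobenioid witness `hF`, some `Δ : Cor26Data τ d hF` exists
and its unit-wise Frobenius functor `Δ.psi` has the printed properties of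
Cor. 2.6: (a) `1`-compatible with the identity on `F_Φ`, (b, first clause) preserves isomorphism classes of
isotropic objects, (c) conjugates into the `d`-th power map on `O^×(A)`, (d, first clause) is an equivalence for
`C` of perfect type (`unitWise_a/b/c/d_holds`). [cite: MochizukiFrdI2008, Cor. 2.6 p.50] -/
theorem exists_cor26Data_unitWise (hS : Setting F) (τ : CharacteristicSplitting F) (d : ℕ+)
    (hF : IsFrobenioid F) :
    ∃ Δ : Cor26Data τ d hF,
      OneCommutes Δ.psi F F (𝟭 (ElemFrobenioid Φ)) ∧
        (∀ A : C, IsIsotropic F A → Nonempty (Δ.psi.obj A ≅ A)) ∧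
        (∀ A : C, IsIsotropic F A → ∃ e : Δ.psi.obj A ≅ A, ∀ u ∈ unitsSubgroup F A,
          e.inv ≫ Δ.psi.map u.hom ≫ e.hom = (u ^ (d : ℕ)).hom) ∧
        (IsOfPerfectType F → Δ.psi.IsEquivalence) := by
  obtain ⟨Δ⟩ := Cor26Data.nonempty_at F hS τ d hF
  exact ⟨Δ, unitWise_a_holds τ d hS hF Δ, (unitWise_b_holds τ d hS hF Δ).1,
    unitWise_c_holds τ d hS hF Δ, (unitWise_d_holds τ d hS hF Δ).1⟩

end FrdI.P25

/-! ### 2. Genuine witness: the `p`-adic Frobenioid of an absolutely primitive datum ([FrdII] Rmk. 1.2.1) -/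

namespace PadicFrd

open PreFrobenioid

namespace Datum

universe v u

variable {D : Type u} [Category.{v} D] {p : ℕ} [Fact p.Prime] (d : Datum D p)

/-- **`NV-L1/FrdI.P25.Setting` at the `p`-adic Frobenioid — GENUINE** (`nonempty_genuine`): for a `p`-adic
Frobenioid datum with `Φ`, `B` monoids on `D` and `Φ` absolutely primitive, `C → F_Φ` satisfies the standing
hypotheses of [FrdI] Prop. 2.5 / Cor. 2.6 — "by Theorem 1.2(i) and (v)" as [FrdII] Rmk. 1.2.1 says: a Frobenioid
([FrdII] Ex. 1.1 (ii)), of Frobenius-normalized (model Frobenioid), metrically trivial (base-trivial, Thm. 1.2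
(v)) and `Aut`-ample (Thm. 1.2 (i)) type. [cite: MochizukiFrdII2008, Rmk 1.2.1 p.10] -/
theorem p25Setting_of_isAbsolutelyPrimitive (h : d.IsMonoidData) (hap : d.IsAbsolutelyPrimitive) :
    FrdI.P25.Setting d.structureFunctor :=
  ⟨d.isFrobenioid_of_isMonoidData h, ModelFrobenioid.isOfType_isFrobeniusNormalized,
    d.isOfType_isMetricallyTrivial_of_isAbsolutelyPrimitive hap, d.thm12_isAutAmple⟩

/-- **`NV-L1/FrdI.P25.Cor26Data` at the characteristic splitting `τ_p`** (`pSplitting`, Thm. 1.2 (v)) of such a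
datum, for every `d ∈ ℕ_{≥1}` — GENUINE. [cite: MochizukiFrdII2008, Rmk 1.2.1 p.10] -/
theorem nonempty_cor26Data_pSplitting (h : d.IsMonoidData) (hap : d.IsAbsolutelyPrimitive) (n : ℕ+) :
    Nonempty (FrdI.P25.Cor26Data (d.pSplitting hap) n (d.isFrobenioid_of_isMonoidData h)) :=
  FrdI.P25.Cor26Data.nonempty_at _ (d.p25Setting_of_isAbsolutelyPrimitive h hap) (d.pSplitting hap) n _

/-- The same for ANY characteristic splitting of such a datum. [cite: MochizukiFrdII2008, Rmk 1.2.1 p.10] -/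
theorem nonempty_cor26Data_of_isAbsolutelyPrimitive (h : d.IsMonoidData) (hap : d.IsAbsolutelyPrimitive)
    (τ : CharacteristicSplitting d.structureFunctor) (n : ℕ+) :
    Nonempty (FrdI.P25.Cor26Data τ n (d.isFrobenioid_of_isMonoidData h)) :=
  FrdI.P25.Cor26Data.nonempty_at _ (d.p25Setting_of_isAbsolutelyPrimitive h hap) τ n _

end Datum

/-! ### 3. Premise-free: `C^⊢(ℚ_p)` with `τ_p` -/

variable (p : ℕ) [Fact p.Prime]

/-- **`NV-L1/FrdI.P25.Setting` at `C^⊢(ℚ_p)`, NO hypotheses** (the absolutely primitive `p`-adic Frobenioid over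
the one-object base `Spec ℚ_p`). [cite: MochizukiFrdII2008, Rmk 1.2.1 p.10] -/
theorem p25Setting_primQp : FrdI.P25.Setting (Datum.primQp p).structureFunctor :=
  (Datum.primQp p).p25Setting_of_isAbsolutelyPrimitive (primQp_isMonoidData p) (primQp_isAbsolutelyPrimitive p)

/-- **`NV-L1/FrdI.P25.Cor26Data` at `(C^⊢(ℚ_p), τ_p)`, NO hypotheses**, for every `d ∈ ℕ_{≥1}`.
[cite: MochizukiFrdII2008, Rmk 1.2.1 p.10] -/
theorem nonempty_cor26Data_primQp (n : ℕ+) :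
    Nonempty (FrdI.P25.Cor26Data (τQp p) n
      ((Datum.primQp p).isFrobenioid_of_isMonoidData (primQp_isMonoidData p))) :=
  FrdI.P25.Cor26Data.nonempty_at _ (p25Setting_primQp p) (τQp p) n _

/-- **The W7 rows (a)–(d) of [FrdI] Cor. 2.6 FIRE at `(C^⊢(ℚ_p), τ_p)`**: for every `d ∈ ℕ_{≥1}` some
`Δ : Cor26Data τ_p d _` on `C^⊢(ℚ_p)` has a unit-wise Frobenius functor `Δ.psi` with the printed properties
(a), (b) first clause, (c), (d) first clause — a genuine nonarchimedean instance of the antecedent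
"`Setting F → ∀ Δ : Cor26Data τ d hF`" of `UnitWise_a/b/c/d`. [cite: MochizukiFrdI2008, Cor. 2.6 p.50] -/
theorem unitWise_abcd_primQp (n : ℕ+) :
    ∃ Δ : FrdI.P25.Cor26Data (τQp p) n
        ((Datum.primQp p).isFrobenioid_of_isMonoidData (primQp_isMonoidData p)),
      OneCommutes Δ.psi (Datum.primQp p).structureFunctor (Datum.primQp p).structureFunctor
          (𝟭 (ElemFrobenioid (Datum.primQp p).Φ)) ∧
        (∀ A : CDashQp p, IsIsotropic (Datum.primQp p).structureFunctor A → Nonempty (Δ.psi.obj A ≅ A)) ∧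
        (∀ A : CDashQp p, IsIsotropic (Datum.primQp p).structureFunctor A → ∃ e : Δ.psi.obj A ≅ A,
          ∀ u ∈ unitsSubgroup (Datum.primQp p).structureFunctor A,
            e.inv ≫ Δ.psi.map u.hom ≫ e.hom = (u ^ (n : ℕ)).hom) ∧
        (IsOfPerfectType (Datum.primQp p).structureFunctor → Δ.psi.IsEquivalence) :=
  FrdI.P25.exists_cor26Data_unitWise _ (p25Setting_primQp p) (τQp p) n _

end PadicFrd

end Literature.AlgebraicGeometry.Frobenioids

end
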